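import Summits.QuantumFields.YangMills.Theorems.LangevinControlUVFemtoCurvatureTwoPointCOddPartialChessboard
import Summits.QuantumFields.YangMills.Theorems.LangevinControlUVFemtoCurvatureTwoPointCBulkDoublingSharp
import Summits.QuantumFields.YangMills.Theorems.LangevinControlUVFemtoCurvatureTwoPointCDefsCore
import HarnessLib

/-!
# Route `LangevinControlUV`, crux `FemtoCurvatureTwoPointC` (stmt-QuantumFields-16204), line
# `conditional-covariance-floor` — stub V′ (`stub_varianceCeilingDeepOdd`), ODD tori in the bulk
# `log β ≤ L⁴`: the variance ceiling WITHOUT the chessboard tiling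

The skeleton stub V′ asks for `Var_{L,β}(P_0^{01}) ≤ C'·u(8,β)²` beyond a threshold (i) on EVEN
window boxes in the deep-femto corner `L⁴ < log β` and (ii) on ODD window boxes `L ≥ 8`. The even
boxes with `log β ≤ L⁴` were closed (p150733, p155166) by the even chessboard estimate (p114602) and
the volume-uniform doubling `Z_L(β/2) ≤ e^{AL⁴} Z_L(β)` (`TorusGauge.uniformDoubling_bulk4`, stated
for ALL `L ≥ 2`). On odd tori the full chessboard estimate is false for general compact `G`
(`FemtoCurvatureTwoPoint.Negative.ChessboardOddTorus`); this file closes the ODD boxes in the same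
bulk regime `log β ≤ L⁴` through the PARTIAL chessboard estimate of `…COddPartialChessboard`
(mixed odd reflection positivity, run doubling to `n > L/2` cells per direction):

* `OddVariance.prod_plaq_sq_le_finset`, `OddVariance.integral_prod_plaq_sq_le`:
  `∫ ∏_{x∈B} P_x² dμ_β ≤ (4/(eβ))^{2|B|} Z_L(β/2)/Z_L(β)` for EVERY non-empty set of sites `B`
  (AM–GM on `B`, `∑_B P_x ≤ S`, `y² ≤ (4/(eβ))² e^{βy/2}`);
* `OddVariance.varianceCeilingOdd_bulk4`: ONE `C = 16 e^{16 max(A,0)}/e²` with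
  `Var_{L,β}(P_0^{01}) ≤ C/β²` for every ODD `L ≥ 3` and `2 ≤ β ≤ e^{L⁴}`
  (`⟨P_0²⟩^{n⁴} ≤ ⟨∏_B P_x²⟩ ≤ (4/(eβ))^{2n⁴} e^{AL⁴}`, `L⁴ < 16 n⁴`);
* `stub_varianceCeilingOddBulk` (registered sub-goal, `--supports stmt-QuantumFields-16204`): the odd
  conjunct of V′ RESTRICTED to `log β ≤ L⁴`, for every R-coupling `u` (only `0 < c₈` and the bare
  size `c₈ ≤ β·u(8,β)` are used), by the arithmetic of `…CBirthVarianceEvenMidStub`.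

What stays open of V′ after this file: the deep-femto corner `log β > L⁴` on BOTH parities (the
`2D·log β` holonomy slack of the torus free-energy sandwich; the partial chessboard does not touch
it). Nothing here is physics beyond the cited landed theorems; no named facts, no new definitions.
-/

set_option autoImplicit false

noncomputable section

open scoped BigOperators
open Filter Topology MeasureTheory
open Literature.MathematicalPhysics.QuantumFieldTheory

namespace Summit.QuantumFields.YangMills.Theorems.FemtoCurvatureTwoPointC.OddVariance

open Summit.QuantumFields.YangMills.Theorems.FemtoCurvatureTwoPoint.PlaquetteVariance

section Pointwise

variable {G : Type*} [Group G] {N : ℕ} (ρ : G →* Matrix (Fin N) (Fin N) ℂ)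

/-- Pointwise bound on the product of the squared `01`-plaquette fields over ANY non-empty set of
sites: `∏_{x∈B} P_x(U)² ≤ (4/(eβ))^{2|B|} · e^{β S(U)/2}` (AM–GM on `B`, `∑_{x∈B} P_x ≤ S`, and the
moment bound `(s/k)^{2k} ≤ (4/(eβ))^{2k} e^{βs/2}`). [folklore] -/
theorem prod_plaq_sq_le_finset {L : ℕ} [NeZero L] (hρN : ∀ g, (ρ g).trace.re ≤ N) {β : ℝ}
    (hβ : 0 < β) (U : GaugeConfig 4 L G) (B : Finset (Site 4 L)) (hB : B.Nonempty) :
    ∏ x ∈ B, ((N : ℝ) - (ρ (plaquetteHolonomy U x 0 1)).trace.re) ^ 2 ≤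
      (4 / (Real.exp 1 * β)) ^ (2 * B.card) * Real.exp (β / 2 * wilsonAction ρ U) := by
  -- adapted from `PlaquetteVariance.prod_plaq_sq_le` (there `B = univ`)
  have h0 : ∀ g, 0 ≤ (N : ℝ) - (ρ g).trace.re := fun g => sub_nonneg.2 (hρN g)
  have hS0 : 0 ≤ wilsonAction ρ U := Finset.sum_nonneg fun _ _ => h0 _
  have hk : 0 < B.card := Finset.card_pos.2 hB
  haveI : Nonempty ↥B := hB.coe_sort
  have hsumB : ∑ x ∈ B, ((N : ℝ) - (ρ (plaquetteHolonomy U x 0 1)).trace.re) ≤ wilsonAction ρ U :=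
    (Finset.sum_le_univ_sum_of_nonneg fun x => h0 _).trans (sum_plaq01_le_wilsonAction ρ hρN U)
  have hsum0 : 0 ≤ ∑ x ∈ B, ((N : ℝ) - (ρ (plaquetteHolonomy U x 0 1)).trace.re) :=
    Finset.sum_nonneg fun _ _ => h0 _
  calc ∏ x ∈ B, ((N : ℝ) - (ρ (plaquetteHolonomy U x 0 1)).trace.re) ^ 2
      = ∏ y : ↥B, ((N : ℝ) - (ρ (plaquetteHolonomy U y 0 1)).trace.re) ^ 2 :=
        (Finset.prod_coe_sort B _).symm
    _ ≤ ((∑ y : ↥B, ((N : ℝ) - (ρ (plaquetteHolonomy U y 0 1)).trace.re)) /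
          Fintype.card ↥B) ^ (2 * Fintype.card ↥B) := prod_sq_le_pow _ fun y => h0 _
    _ = ((∑ x ∈ B, ((N : ℝ) - (ρ (plaquetteHolonomy U x 0 1)).trace.re)) / B.card) ^
          (2 * B.card) := by
        rw [Finset.sum_coe_sort B fun x => (N : ℝ) - (ρ (plaquetteHolonomy U x 0 1)).trace.re,
          Fintype.card_coe]
    _ ≤ (wilsonAction ρ U / B.card) ^ (2 * B.card) := by gcongr
    _ ≤ (4 / (Real.exp 1 * β)) ^ (2 * B.card) * Real.exp (β / 2 * wilsonAction ρ U) :=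
        div_pow_le_mul_exp hS0 hβ hk

end Pointwise

section Wilson

variable {G : Type*} [Group G] [TopologicalSpace G] [IsTopologicalGroup G] [CompactSpace G]
  [MeasurableSpace G] [BorelSpace G] {N : ℕ} (ρ : G →* Matrix (Fin N) (Fin N) ℂ)

/-- **`∫ ∏_{x∈B} P_x² dμ_β ≤ (4/(eβ))^{2|B|} · Z(β/2)/Z(β)`** for every non-empty set of sites `B`
(integrate `prod_plaq_sq_le_finset`; `⟨e^{βS/2}⟩_β = Z(β/2)/Z(β)`). [folklore] -/
theorem integral_prod_plaq_sq_le {L : ℕ} [NeZero L] (hρ : Continuous ρ) {β : ℝ} (hβ : 0 < β)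
    (B : Finset (Site 4 L)) (hB : B.Nonempty) :
    ∫ U, ∏ x ∈ B, ((N : ℝ) - (ρ (plaquetteHolonomy U x 0 1)).trace.re) ^ 2
        ∂(wilsonMeasure (d := 4) (L := L) ρ β) ≤
      (4 / (Real.exp 1 * β)) ^ (2 * B.card) *
        ((partitionFunction (d := 4) (L := L) ρ (β / 2)).toReal /
          (partitionFunction (d := 4) (L := L) ρ β).toReal) := by
  -- adapted from `PlaquetteVariance.wilsonExpectation_prod_sq_le`
  haveI := isProbabilityMeasure_wilsonMeasure (d := 4) (L := L) ρ hρ β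
  rw [← wilsonExpectation_exp_half_mul ρ hρ β]
  unfold wilsonExpectation
  rw [← integral_const_mul]
  refine integral_mono_of_nonneg (ae_of_all _ fun U => ?_)
    ((integrable_exp_mul_wilsonAction ρ hρ (β / 2) _).const_mul _) (ae_of_all _ fun U => ?_)
  · exact Finset.prod_nonneg fun x _ => sq_nonneg _
  · exact prod_plaq_sq_le_finset ρ (re_trace_le ρ hρ) hβ U B hB

end Wilson

/-- **The variance ceiling on ODD tori up to the holonomy corner, volume-uniform.** For every
compact group `G` with a lattice representation `r`: ONE `C = 16 e^{16 max(A,0)} / e²` with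
`⟨P_0 P_0⟩_β − ⟨P_0⟩_β² ≤ C · (β²)⁻¹` for every ODD torus `(ℤ/L)⁴`, `L ≥ 3`, and `2 ≤ β ≤ e^{L⁴}`,
`P_0 = N − Re tr r.ρ(U_{0;01})` — the partial chessboard `odd_partialChessboard` (`n⁴` sites,
`L < 2n`) run with `f = min(t², 4N²)`, the pointwise bound on `∏_{x∈B} P_x²`, and the uniform
doubling `uniformDoubling_bulk4` (`Z_L(β/2) ≤ e^{AL⁴} Z_L(β)`, all `L ≥ 2`); `L⁴/n⁴ < 16`. -/
theorem varianceCeilingOdd_bulk4 :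
    ∀ {G : Type} [Group G] [TopologicalSpace G] [IsTopologicalGroup G] [CompactSpace G]
      [MeasurableSpace G] [BorelSpace G] (r : LatticeRep G),
      ∃ C : ℝ, ∀ (L : ℕ) [NeZero L], Odd L → 3 ≤ L → ∀ β : ℝ, 2 ≤ β → Real.log β ≤ (L : ℝ) ^ 4 →
        ∀ (P : (Fin 4 → ZMod L) → Fin 4 → Fin 4 → GaugeConfig 4 L G → ℝ)
          (E : (GaugeConfig 4 L G → ℝ) → ℝ),
          (P = fun x i j U => (r.N : ℝ) - (r.ρ (plaquetteHolonomy U x i j)).trace.re) →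
          (E = fun F => wilsonExpectation r.ρ β F) →
          E (fun U => P 0 0 1 U * P 0 0 1 U) - E (P 0 0 1) * E (P 0 0 1) ≤ C * (β ^ 2)⁻¹ := by
  intro G i1 i2 i3 i4 i5 i6 r
  -- `G` is second countable: it embeds into `M_N(ℂ)` through the faithful `r`
  haveI : SecondCountableTopology (Matrix (Fin r.N) (Fin r.N) ℂ) :=
    inferInstanceAs (SecondCountableTopology (Fin r.N → Fin r.N → ℂ))
  haveI : SecondCountableTopology G :=
    (r.continuous.isClosedEmbedding r.injective).isEmbedding.secondCountableTopology
  obtain ⟨A, hA⟩ := TorusGauge.uniformDoubling_bulk4 r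
  refine ⟨16 * Real.exp (16 * max A 0) / Real.exp 1 ^ 2, ?_⟩
  intro L iL hL hL3 β hβ hlogβ P E hP hE
  subst hP hE
  dsimp only
  have hβ0 : 0 < β := by linarith
  have hL2 : 2 ≤ L := by omega
  -- the doubling at `(L, β)`
  have hdbl : (partitionFunction (d := 4) (L := L) r.ρ (β / 2)).toReal ≤
      Real.exp (A * (L : ℝ) ^ 4) * (partitionFunction (d := 4) (L := L) r.ρ β).toReal :=
    hA L β hL2 hβ hlogβ
  -- (i) `|Var P| ≤ ⟨P²⟩`
  have hXm := measurable_plaq01 r.ρ r.continuous (0 : Site 4 L)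
  have hXb : ∀ U : GaugeConfig 4 L G,
      |(r.N : ℝ) - (r.ρ (plaquetteHolonomy U 0 0 1)).trace.re| ≤ 2 * r.N := fun U => by
    obtain ⟨h0, h2'⟩ := plaqField_mem r.ρ r.continuous (plaquetteHolonomy U 0 0 1)
    rw [abs_of_nonneg h0]
    exact h2'
  have hvar := abs_var_le_wilsonExpectation_sq r.ρ r.continuous β hXm hXb
  -- (ii) the partial chessboard on the odd torus with `f = min (t², 4N²)`, `f(P_x) = P_x²`
  have hmin : ∀ (U : GaugeConfig 4 L G) (x : Site 4 L),
      min (((r.N : ℝ) - (r.ρ (plaquetteHolonomy U x 0 1)).trace.re) ^ 2) ((2 * (r.N : ℝ)) ^ 2) =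
        ((r.N : ℝ) - (r.ρ (plaquetteHolonomy U x 0 1)).trace.re) ^ 2 := fun U x => by
    obtain ⟨h0, h2'⟩ := plaqField_mem r.ρ r.continuous (plaquetteHolonomy U x 0 1)
    exact min_eq_left (pow_le_pow_left₀ h0 h2' 2)
  obtain ⟨n, hn, B, hBcard, hch⟩ := OddChessboard.odd_partialChessboard r.ρ hL hL3 r.continuous
    hβ0.le (f := fun t => min (t ^ 2) ((2 * (r.N : ℝ)) ^ 2))
    ((continuous_id.pow 2).min continuous_const).measurable
    (fun t => le_min (sq_nonneg t) (sq_nonneg _))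
    (M := (2 * (r.N : ℝ)) ^ 2) (fun t => by
      rw [abs_of_nonneg (le_min (sq_nonneg t) (sq_nonneg _))]; exact min_le_right _ _)
  simp only [hmin] at hch
  have hn0 : 0 < n := by omega
  have hBne : B.Nonempty := Finset.card_pos.1 (by rw [hBcard]; positivity)
  -- (iii) `∫ ∏_{x∈B} P_x² ≤ (4/(eβ))^{2n⁴} e^{AL⁴}`
  have hprod : ∫ U, ∏ x ∈ B, ((r.N : ℝ) - (r.ρ (plaquetteHolonomy U x 0 1)).trace.re) ^ 2
      ∂(wilsonMeasure (d := 4) (L := L) r.ρ β) ≤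
        (4 / (Real.exp 1 * β)) ^ (2 * n ^ 4) * Real.exp (A * (L : ℝ) ^ 4) := by
    refine (integral_prod_plaq_sq_le r.ρ r.continuous hβ0 B hBne).trans ?_
    have hZ := partitionFunction_toReal_pos (d := 4) (L := L) r.ρ r.continuous β
    have hratio : (partitionFunction (d := 4) (L := L) r.ρ (β / 2)).toReal /
        (partitionFunction (d := 4) (L := L) r.ρ β).toReal ≤ Real.exp (A * (L : ℝ) ^ 4) := by
      rw [div_le_iff₀ hZ]
      exact hdbl
    rw [hBcard]
    exact mul_le_mul_of_nonneg_left hratio (pow_nonneg (by positivity) _)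
  -- (iv) the `n⁴`-th root: `⟨P²⟩ ≤ (4/(eβ))² e^{AL⁴/n⁴}`
  set a : ℝ := ∫ U, ((r.N : ℝ) - (r.ρ (plaquetteHolonomy U 0 0 1)).trace.re) ^ 2
    ∂(wilsonMeasure (d := 4) (L := L) r.ρ β) with ha
  set b : ℝ := (4 / (Real.exp 1 * β)) ^ 2 * Real.exp (A * (L : ℝ) ^ 4 / (n : ℝ) ^ 4) with hb
  have hb0 : 0 ≤ b := by positivity
  have hn4 : ((n : ℝ) ^ 4) ≠ 0 := by positivity
  have hbn : b ^ (n ^ 4) = (4 / (Real.exp 1 * β)) ^ (2 * n ^ 4) * Real.exp (A * (L : ℝ) ^ 4) := by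
    rw [hb, mul_pow, ← pow_mul, ← Real.exp_nat_mul]
    congr 2
    push_cast
    field_simp
  have hab : a ≤ b :=
    le_of_pow_le_pow_left₀ (pow_ne_zero 4 hn0.ne') hb0 (by rw [hbn]; exact hch.trans hprod)
  -- (v) `e^{AL⁴/n⁴} ≤ e^{16 max(A,0)}` since `L < 2n`
  have hL2n : (L : ℝ) ^ 4 ≤ 16 * (n : ℝ) ^ 4 := by
    have h : (L : ℝ) ≤ 2 * n := by exact_mod_cast hn.le
    calc (L : ℝ) ^ 4 ≤ (2 * (n : ℝ)) ^ 4 := pow_le_pow_left₀ (by positivity) h 4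
      _ = 16 * (n : ℝ) ^ 4 := by ring
  have hexp : Real.exp (A * (L : ℝ) ^ 4 / (n : ℝ) ^ 4) ≤ Real.exp (16 * max A 0) := by
    refine Real.exp_le_exp.2 ?_
    rw [div_le_iff₀ (by positivity)]
    have h1 : A * (L : ℝ) ^ 4 ≤ max A 0 * (L : ℝ) ^ 4 :=
      mul_le_mul_of_nonneg_right (le_max_left _ _) (by positivity)
    have h2 : max A 0 * (L : ℝ) ^ 4 ≤ max A 0 * (16 * (n : ℝ) ^ 4) :=
      mul_le_mul_of_nonneg_left hL2n (le_max_right _ _)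
    linarith
  -- assembly
  have hβne : β ≠ 0 := hβ0.ne'
  calc _ ≤ a := (le_abs_self _).trans hvar
    _ ≤ b := hab
    _ ≤ (4 / (Real.exp 1 * β)) ^ 2 * Real.exp (16 * max A 0) :=
        mul_le_mul_of_nonneg_left hexp (by positivity)
    _ = 16 * Real.exp (16 * max A 0) / Real.exp 1 ^ 2 * (β ^ 2)⁻¹ := by
        field_simp
        ring

end Summit.QuantumFields.YangMills.Theorems.FemtoCurvatureTwoPointC.OddVariance

namespace Summit.QuantumFields.YangMills.Theorems.FemtoCurvatureTwoPointC

/-- **Variance combination (pure real arithmetic).** From the bare size `c₈ ≤ β·t` with `0 < c₈`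
and `1 ≤ β`, and a bare variance ceiling `V ≤ C₃·(β²)⁻¹`: `V ≤ (max C₃ 0 / c₈²)·t²`. [folklore] -/
-- adapted from `variance_combine_mid` of `…CBirthVarianceEvenMidStub` (p155166, private there)
private theorem variance_combine_odd {V C₃ c₈ β t : ℝ} (hc₈ : 0 < c₈) (hβ : 1 ≤ β)
    (hbare : c₈ ≤ β * t) (hV : V ≤ C₃ * (β ^ 2)⁻¹) :
    V ≤ max C₃ 0 / c₈ ^ 2 * t ^ 2 := by
  have hβpos : 0 < β := one_pos.trans_le hβ
  have hβ2 : 0 < β ^ 2 := pow_pos hβpos 2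
  have hc2 : 0 < c₈ ^ 2 := pow_pos hc₈ 2
  have hsq : c₈ ^ 2 ≤ β ^ 2 * t ^ 2 := by
    rw [← mul_pow]
    exact pow_le_pow_left₀ hc₈.le hbare 2
  have hinv : (β ^ 2)⁻¹ ≤ t ^ 2 / c₈ ^ 2 := by
    rw [inv_eq_one_div, div_le_div_iff₀ hβ2 hc2]
    linarith [hsq]
  calc V ≤ C₃ * (β ^ 2)⁻¹ := hV
    _ ≤ max C₃ 0 * (β ^ 2)⁻¹ :=
        mul_le_mul_of_nonneg_right (le_max_left _ _) (inv_nonneg.mpr hβ2.le)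
    _ ≤ max C₃ 0 * (t ^ 2 / c₈ ^ 2) := mul_le_mul_of_nonneg_left hinv (le_max_right _ _)
    _ = max C₃ 0 / c₈ ^ 2 * t ^ 2 := by ring

/-- **Registered sub-goal `stub_varianceCeilingOddBulk` — stub V′ of line
`conditional-covariance-floor` (= line `birth`'s `stub_varianceCeilingOdd`) RESTRICTED to the bulk
`log β ≤ L⁴`.** For a compact simple Lie group `G`, a lattice representation `r`, and a GIVEN box
coupling `u` with constants `u₀ β₀ κ₁ κ₂ κ₃ c C c₈` carrying the R-bundle, there are `β₁ C'` such
that on every ODD window box `L ≥ 8` with `log β ≤ L⁴` beyond `β₁` the plaquette variance is bounded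
by the running coupling squared: `E(P_0^{01}·P_0^{01}) - E(P_0^{01})² ≤ C'·u(8,β)²`. Witnesses:
`β₁ = max β₀ 2`, `C' = max C₅ 0 / c₈²` with `C₅` the constant of
`OddVariance.varianceCeilingOdd_bulk4` (partial chessboard on odd tori + uniform doubling). Only
`0 < c₈` and the bare-size clause of the R-bundle are used; the window hypothesis and compact
simplicity are not used. -/
theorem stub_varianceCeilingOddBulk :
    ∀ (G : Type) [Group G] [TopologicalSpace G] [IsTopologicalGroup G] [CompactSpace G]
        [MeasurableSpace G] [BorelSpace G], IsCompactSimpleLieGroup G →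
        ∀ r : LatticeRep G, ∀ (u : ℕ → ℝ → ℝ) (u₀ β₀ κ₁ κ₂ κ₃ c C c₈ : ℝ),
      (0 < u₀ ∧ 0 < c ∧ 0 < κ₁ ∧ 0 ≤ κ₃ ∧ 0 < c₈ ∧
        (∀ (L : ℕ) (β : ℝ), 8 ≤ L → β₀ ≤ β → 0 < u L β) ∧
        (∀ L : ℕ, 8 ≤ L → ContinuousOn (u L) (Set.Ici β₀)) ∧
        (∀ L : ℕ, 8 ≤ L → Filter.Tendsto (u L) Filter.atTop (nhds 0)) ∧
        (∀ β : ℝ, β₀ ≤ β → c₈ ≤ β * u 8 β) ∧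
        (∀ (L L' : ℕ) (β : ℝ), β₀ ≤ β → 8 ≤ L → L ≤ L' → L' ≤ 2 * L →
            (∀ M : ℕ, 8 ≤ M → M ≤ L → u M β ≤ u₀) → |(u L β)⁻¹ - (u L' β)⁻¹| ≤ κ₂) ∧
        (∀ (k m : ℕ) (β : ℝ), β₀ ≤ β → (∀ M : ℕ, 8 ≤ M → M ≤ 8 * 2 ^ (k + m) → u M β ≤ u₀) →
            κ₁ * m - κ₃ ≤ (u (8 * 2 ^ k) β)⁻¹ - (u (8 * 2 ^ (k + m)) β)⁻¹ ∧
              (u (8 * 2 ^ k) β)⁻¹ - (u (8 * 2 ^ (k + m)) β)⁻¹ ≤ κ₂ * m + κ₃) ∧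
        (∀ (L : ℕ) [NeZero L] (β : ℝ), β₀ ≤ β → 8 ≤ L →
            (∀ M : ℕ, 8 ≤ M → M ≤ L → u M β ≤ u₀) →
            ∀ (P : (Fin 4 → ZMod L) → Fin 4 → Fin 4 → GaugeConfig 4 L G → ℝ)
              (E : (GaugeConfig 4 L G → ℝ) → ℝ),
              (P = fun x i j U => (r.N : ℝ) - (r.ρ (plaquetteHolonomy U x i j)).trace.re) →
              (E = fun F => wilsonExpectation r.ρ β F) →
              c * u L β ^ 2 ≤
                ((L / 8 : ℕ) : ℝ) ^ 8 * (E (fun U => P 0 0 1 U * P (Pi.single (2 : Fin 4) ((L / 8 : ℕ) : ZMod L)) 0 1 U)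
                  - E (P 0 0 1) * E (P (Pi.single (2 : Fin 4) ((L / 8 : ℕ) : ZMod L)) 0 1)) ∧
              ((L / 8 : ℕ) : ℝ) ^ 8 * (E (fun U => P 0 0 1 U * P (Pi.single (2 : Fin 4) ((L / 8 : ℕ) : ZMod L)) 0 1 U)
                - E (P 0 0 1) * E (P (Pi.single (2 : Fin 4) ((L / 8 : ℕ) : ZMod L)) 0 1)) ≤ C * u L β ^ 2)) →
      ∃ (β₁ C' : ℝ),
        (∀ (L : ℕ) [NeZero L] (β : ℝ), β₁ ≤ β → 8 ≤ L → Odd L → Real.log β ≤ (L : ℝ) ^ 4 →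
            (∀ M : ℕ, 8 ≤ M → M ≤ L → u M β ≤ u₀) →
            ∀ (P : (Fin 4 → ZMod L) → Fin 4 → Fin 4 → GaugeConfig 4 L G → ℝ)
              (E : (GaugeConfig 4 L G → ℝ) → ℝ),
              (P = fun x i j U => (r.N : ℝ) - (r.ρ (plaquetteHolonomy U x i j)).trace.re) →
              (E = fun F => wilsonExpectation r.ρ β F) →
              E (fun U => P 0 0 1 U * P 0 0 1 U) - E (P 0 0 1) * E (P 0 0 1) ≤ C' * u 8 β ^ 2) := by
  intro G _ _ _ _ _ _ _ r u u₀ β₀ κ₁ κ₂ κ₃ c C c₈ hR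
  obtain ⟨-, -, -, -, hc₈, -, -, -, hbare, -, -, -⟩ := hR
  -- the `u`-free odd ceiling `Var ≤ C₅ / β²` up to the holonomy corner `log β ≤ L⁴`
  obtain ⟨Cb, hCb⟩ := OddVariance.varianceCeilingOdd_bulk4 r
  refine ⟨max β₀ 2, max Cb 0 / c₈ ^ 2, ?_⟩
  intro L _ β hβ hL hOdd hlog _ P E hP hE
  have hβ₀ : β₀ ≤ β := (le_max_left _ _).trans hβ
  have hβ2 : (2 : ℝ) ≤ β := (le_max_right _ _).trans hβ
  have hβ1 : (1 : ℝ) ≤ β := by linarith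
  have hL3 : 3 ≤ L := by omega
  -- the ceiling on the odd box `L ≥ 3` at coupling `2 ≤ β`, `log β ≤ L⁴`
  have hvar := hCb L hOdd hL3 β hβ2 hlog P E hP hE
  -- the bare size at `β ≥ β₀`
  have hbs : c₈ ≤ β * u 8 β := hbare β hβ₀
  exact variance_combine_odd hc₈ hβ1 hbs hvar

end Summit.QuantumFields.YangMills.Theorems.FemtoCurvatureTwoPointC

end
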